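/-
HONEST FRAMING: exact (Metropolis-corrected) sampling algorithms for lattice gauge theory; figures of merit
are autocorrelation/cost numbers at stated couplings and volumes; no continuum-physics claim.
-/
import Mathlib
import Summits.Ventures.LatticeQCDFlow.TrivializingMaps.GradedTransfer
import Summits.Ventures.LatticeQCDFlow.TrivializingMaps.TheoremAReduction

/-!
# Theorem A: the volume-uniform geometric gradient bound for Lüscher's series (THEORY-1 §19, step (6d))

Venture-side (`Summits/Ventures/LatticeQCDFlow/`), never `Literature/`.  We close the open node
`LuscherGeometricGradientBound d n` (`Truncation.lean` §6; Lüscher 2010, §4: the perturbative series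
`S̃ = ∑_k t^k S̃^{(k)}` of the trivializing flow action has link gradients `|∂^a_e S̃^{(k)}| ≤ C ρ^{-k}` on
`SU(n)^E`, UNIFORMLY IN THE VOLUME) by the Peter–Weyl-free mass-transfer argument of THEORY-1 §19:

1. `gen0_mass_le`: the link masses of generation 0 (the re-graded Wilson action) are `≤ N₀ = 4d²·n⁴/√(n/4)`;
2. `mass_pack_le`: by the one-step contraction (`GradedTransfer.Gen.step_mass_le`) the link masses of
   generation `k` are `≤ N₀ θ₁^k`, `θ₁ = max(θ, 1)`, all constants depending on `(d, n, B)` only;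
3. `abs_linkDeriv_wilsonSk_le`: the tree's series `wilsonSk` has the same link gradients as the graded
   series (`GradedSeries.linkDeriv_eq_gradedSk`, via `SeriesUniqueness`), which are dominated by the link
   masses (`GradedMasses.Gen.abs_linkDeriv_func_le`);
4. `luscherGeometricGradientBound_holds`: Theorem A, via the tree's reduction to a fixed basis
   (`TheoremAReduction.luscherGeometricGradientBound_iff_fixedBasis`); the cases `n = 0` and "no basis"
   are vacuous.

0 sorry.  [ours; the statement is Lüscher's (cite: Luscher2010Trivializing §4), the proof is new]
-/

namespace Summit.Ventures.LatticeQCDFlow.TrivializingMaps.GradedSeries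

open scoped ComplexConjugate Matrix Matrix.Norms.Frobenius InnerProductSpace ContDiff
open Finset
open Literature.MathematicalPhysics.QuantumFieldTheory
open Literature.MathematicalPhysics.QuantumFieldTheory.Luscher2010
open SlotRepresentation SlotCasimir SlotCoefficient SlotHilbert JointGrading CasimirGrading PlaquetteData
  SlotTensor TensorShift RankOne Vertex MassTransfer

variable {d L n : ℕ} [NeZero L]

/-! ## 1. The link masses of generation 0 -/

section Init
variable (B : SuBasis n)

omit [NeZero L] in
/-- `‖zneg c‖ ≤ c⁻¹` (`c ≥ 0`). [ours] -/
theorem norm_zneg_le {c : ℝ} (hc : 0 ≤ c) : ‖zneg c‖ ≤ c⁻¹ := by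
  unfold zneg
  split_ifs with h
  · rw [norm_zero, h, inv_zero]
  · rw [norm_neg, Complex.norm_real, Real.norm_of_nonneg (inv_nonneg.2 hc)]

/-- `‖z_j‖ ≤ c(m_j)⁻¹` in generation 0. [ours] -/
theorem norm_gen0_z_le (j : (gen0 (d := d) (L := L) B).I) :
    ‖(gen0 (d := d) (L := L) B).z j‖ ≤ ((gen0 (d := d) (L := L) B).cm j)⁻¹ := by
  have hc : 0 ≤ (gen0 (d := d) (L := L) B).cm j := (gen0 (d := d) (L := L) B).cm_nonneg j
  have hc' : (gen0 (d := d) (L := L) B).cm j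
      = modeC (plaqIdx (d := d) (L := L) j.1.1.1 j.1.1.2.1 j.1.1.2.2) plaqPol B j.2 := rfl
  show ‖(if j.1.1.2.1 < j.1.1.2.2
      then zneg (modeC (plaqIdx (d := d) (L := L) j.1.1.1 j.1.1.2.1 j.1.1.2.2) plaqPol B j.2) else 0)‖
    ≤ ((gen0 (d := d) (L := L) B).cm j)⁻¹
  rw [hc'] at hc ⊢
  split_ifs
  · exact norm_zneg_le hc
  · rw [norm_zero]; exact inv_nonneg.2 hc

/-- The initial constant `N₀ = 4d² · n⁴ / √(n/4)`. [ours] -/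
noncomputable def N0 (d n : ℕ) : ℝ := ((4 * (d * d) : ℕ) : ℝ) * ((n : ℝ) ^ 4 * (1 / Real.sqrt ((n : ℝ) / 4)))

/-- `N₀ ≥ 0`. [ours] -/
theorem N0_nonneg (d n : ℕ) : 0 ≤ N0 d n := by unfold N0; positivity

/-- The per-datum bound in generation 0: for a live `j = ⟨(p, c), m⟩`,
`√(m_e) ν_j ≤ [e ∈ p] · ‖P_m κ_c‖ ‖P_m β_c‖ / √(n/4)`. [ours] -/
theorem gen0_term_le (hn : n ≠ 0) (e : Edge d L) (j : (gen0 (d := d) (L := L) B).I)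
    (hj : j ∈ (gen0 (d := d) (L := L) B).live) :
    (gen0 (d := d) (L := L) B).wt j e * (gen0 (d := d) (L := L) B).nu j
      ≤ if e ∈ plaqLinks d L j.1.1 then (1 / Real.sqrt ((n : ℝ) / 4))
          * (‖(gen0 (d := d) (L := L) B).x j‖ * ‖(gen0 (d := d) (L := L) B).y j‖) else 0 := by
  have hγ : 0 < (n : ℝ) / 4 := div_pos (Nat.cast_pos.2 (Nat.pos_of_ne_zero hn)) four_pos
  have hsγ : 0 < Real.sqrt ((n : ℝ) / 4) := Real.sqrt_pos.2 hγ
  -- abbreviations (all definitional)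
  obtain ⟨c₀, hc₀⟩ : ∃ c₀ : ℝ, (gen0 (d := d) (L := L) B).cm j = c₀ := ⟨_, rfl⟩
  obtain ⟨w₀, hw₀⟩ : ∃ w₀ : ℝ, (gen0 (d := d) (L := L) B).wt j e = w₀ := ⟨_, rfl⟩
  obtain ⟨z₀, hz₀⟩ : ∃ z₀ : ℂ, (gen0 (d := d) (L := L) B).z j = z₀ := ⟨_, rfl⟩
  have hnu : (gen0 (d := d) (L := L) B).nu j
      = ‖z₀‖ * (‖(gen0 (d := d) (L := L) B).x j‖ * ‖(gen0 (d := d) (L := L) B).y j‖) := by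
    unfold Gen.nu; rw [hz₀]
  split_ifs with he
  · -- on the plaquette: `wt ≤ √c`, `‖z‖ ≤ 1/c`, `c ≥ n/4`
    have hcm : (n : ℝ) / 4 ≤ c₀ := hc₀ ▸ (gen0 (d := d) (L := L) B).quarter_le_cm hn hj
    have hcm0 : 0 < c₀ := hγ.trans_le hcm
    have hwt : w₀ ≤ Real.sqrt c₀ :=
      hw₀ ▸ hc₀ ▸ sqrt_mode_le_sqrt_modeC ((gen0 (d := d) (L := L) B).lnk j)
        ((gen0 (d := d) (L := L) B).pol j) B ((gen0 (d := d) (L := L) B).m j) e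
    have hz : ‖z₀‖ ≤ c₀⁻¹ := hz₀ ▸ hc₀ ▸ norm_gen0_z_le B j
    have hw0 : 0 ≤ w₀ := hw₀ ▸ (gen0 (d := d) (L := L) B).wt_nonneg j e
    have hkey : w₀ * ‖z₀‖ ≤ 1 / Real.sqrt ((n : ℝ) / 4) := by
      rw [le_div_iff₀ hsγ]
      calc w₀ * ‖z₀‖ * Real.sqrt ((n : ℝ) / 4) ≤ Real.sqrt c₀ * c₀⁻¹ * Real.sqrt c₀ :=
            mul_le_mul (mul_le_mul hwt hz (norm_nonneg _) (Real.sqrt_nonneg _)) (Real.sqrt_le_sqrt hcm)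
              (Real.sqrt_nonneg _) (mul_nonneg (Real.sqrt_nonneg _) (inv_nonneg.2 hcm0.le))
        _ = Real.sqrt c₀ * Real.sqrt c₀ * c₀⁻¹ := by ring
        _ = 1 := by rw [Real.mul_self_sqrt hcm0.le, mul_inv_cancel₀ hcm0.ne']
    rw [hw₀, hnu, ← mul_assoc]
    exact mul_le_mul_of_nonneg_right hkey (by positivity)
  · -- off the plaquette the weight vanishes
    have h0 : (((gen0 (d := d) (L := L) B).m j e : ℂ)) = 0 :=
      mode_eq_zero_of_forall_ne ((gen0 (d := d) (L := L) B).lnk j) ((gen0 (d := d) (L := L) B).pol j) B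
        (not_mem_plaqLinks.1 he) ((gen0 (d := d) (L := L) B).m j)
    have hw : (gen0 (d := d) (L := L) B).wt j e = 0 := by unfold Gen.wt; rw [h0]; simp
    rw [hw, zero_mul]

/-- **Initial bound**: `N_{G₀}(e) ≤ N₀` for every link `e`, uniformly in `L`. [ours] -/
theorem gen0_mass_le (hn : n ≠ 0) (e : Edge d L) : (gen0 (d := d) (L := L) B).mass e ≤ N0 d n := by
  set G0 := gen0 (d := d) (L := L) B with hG0
  set κ' : ℝ := 1 / Real.sqrt ((n : ℝ) / 4) with hκ'
  have hκ'0 : 0 ≤ κ' := by rw [hκ']; positivity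
  let g : G0.I → ℝ := fun j =>
    if e ∈ plaqLinks d L j.1.1 then κ' * (‖G0.x j‖ * ‖G0.y j‖) else 0
  have hg0 : ∀ j, 0 ≤ g j := fun j => by
    simp only [g]; split_ifs
    · positivity
    · exact le_rfl
  have h1 : G0.mass e ≤ ∑ j, g j :=
    (Finset.sum_le_sum fun j hj => gen0_term_le B hn e j hj).trans (Finset.sum_le_univ_sum_of_nonneg hg0)
  -- sum the bound: modes (re-grading loses nothing), colour cycles (`n⁴`), plaquettes through `e` (`4d²`)
  have h2 : ∑ j, g j = ∑ p : Site d L × Fin d × Fin d, ∑ c : Fin n × Fin n × Fin n × Fin n,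
      ∑ mo : Modes (casimirFamily (plaqIdx (d := d) (L := L) p.1 p.2.1 p.2.2) plaqPol B),
        g ⟨(p, c), mo⟩ := sum_Idx0 B g
  have h3 : ∀ (p : Site d L × Fin d × Fin d) (c : Fin n × Fin n × Fin n × Fin n),
      ∑ mo : Modes (casimirFamily (plaqIdx (d := d) (L := L) p.1 p.2.1 p.2.2) plaqPol B),
        ‖G0.x ⟨(p, c), mo⟩‖ * ‖G0.y ⟨(p, c), mo⟩‖ ≤ 1 := by
    intro p c
    have h := sum_norm_jointProj_mul_le (plaqIdx (d := d) (L := L) p.1 p.2.1 p.2.2) plaqPol B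
      (pv (ketIdx c)) (pv (braIdx c))
    rw [norm_pv, norm_pv, mul_one] at h
    exact h
  have h4 : ∀ p : Site d L × Fin d × Fin d, ∑ c : Fin n × Fin n × Fin n × Fin n,
      ∑ mo : Modes (casimirFamily (plaqIdx (d := d) (L := L) p.1 p.2.1 p.2.2) plaqPol B), g ⟨(p, c), mo⟩
        ≤ if e ∈ plaqLinks d L p then κ' * (n : ℝ) ^ 4 else 0 := by
    intro p
    by_cases hp : e ∈ plaqLinks d L p
    · simp only [g, hp, if_true]
      calc ∑ c : Fin n × Fin n × Fin n × Fin n,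
            ∑ mo : Modes (casimirFamily (plaqIdx (d := d) (L := L) p.1 p.2.1 p.2.2) plaqPol B),
              κ' * (‖G0.x ⟨(p, c), mo⟩‖ * ‖G0.y ⟨(p, c), mo⟩‖)
          ≤ ∑ _c : Fin n × Fin n × Fin n × Fin n, κ' := by
            refine Finset.sum_le_sum fun c _ => ?_
            rw [← Finset.mul_sum]
            exact (mul_le_mul_of_nonneg_left (h3 p c) hκ'0).trans (le_of_eq (mul_one _))
        _ = κ' * (n : ℝ) ^ 4 := by
            rw [Finset.sum_const, Finset.card_univ, nsmul_eq_mul]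
            simp only [Fintype.card_prod, Fintype.card_fin]
            push_cast; ring
    · simp only [g, hp, if_false]
      simp
  have h5 : ∑ p : Site d L × Fin d × Fin d, (if e ∈ plaqLinks d L p then κ' * (n : ℝ) ^ 4 else 0)
      ≤ N0 d n := by
    rw [← Finset.sum_filter, Finset.sum_const, nsmul_eq_mul]
    unfold N0
    have hc := card_through_le (d := d) (L := L) e
    have : ((Finset.univ.filter fun p : Site d L × Fin d × Fin d => e ∈ plaqLinks d L p).card : ℝ)
        ≤ ((4 * (d * d) : ℕ) : ℝ) := by exact_mod_cast hc
    rw [hκ']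
    exact mul_le_mul this (le_of_eq (mul_comm _ _)) (by positivity) (by positivity)
  calc G0.mass e ≤ ∑ j, g j := h1
    _ = _ := h2
    _ ≤ ∑ p : Site d L × Fin d × Fin d, (if e ∈ plaqLinks d L p then κ' * (n : ℝ) ^ 4 else 0) :=
        Finset.sum_le_sum fun p _ => h4 p
    _ ≤ N0 d n := h5

end Init

/-! ## 2. Geometric growth of the link masses -/

section Growth
variable (B : SuBasis n)

/-- Dead data carry no coefficient, in every generation. [ours] -/
theorem pack_z_eq_zero (k : ℕ) :
    ∀ i, (pack (d := d) (L := L) B k).G.cm i = 0 → (pack (d := d) (L := L) B k).G.z i = 0 := by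
  cases k with
  | zero => exact gen0_z_eq_zero B
  | succ k => exact (pack (d := d) (L := L) B k).G.step_z_eq_zero

/-- The rate `θ₁ = max(θ, 1) ≥ 1`. [ours] -/
noncomputable def theta1 (d n : ℕ) (B : SuBasis n) : ℝ := max (theta d n B) 1

omit [NeZero L] in
/-- `1 ≤ θ₁`. [ours] -/
theorem one_le_theta1 (d n : ℕ) (B : SuBasis n) : 1 ≤ theta1 d n B := le_max_right _ _

/-- **Geometric growth**: `N_{G_k}(e) ≤ N₀ θ₁^k` for every link and every volume. [ours] -/
theorem mass_pack_le (hn : n ≠ 0) (k : ℕ) (e : Edge d L) :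
    (pack (d := d) (L := L) B k).G.mass e ≤ N0 d n * theta1 d n B ^ k := by
  induction k generalizing e with
  | zero => rw [pow_zero, mul_one]; exact gen0_mass_le B hn e
  | succ k ih =>
    have h := (pack (d := d) (L := L) B k).G.step_mass_le hn (pack_z_eq_zero B k) ih e
    have hθ : theta d n B ≤ theta1 d n B := le_max_left _ _
    have hN : 0 ≤ N0 d n * theta1 d n B ^ k :=
      mul_nonneg (N0_nonneg d n) (pow_nonneg (zero_le_one.trans (one_le_theta1 d n B)) k)
    calc (pack (d := d) (L := L) B (k + 1)).G.mass e = (pack (d := d) (L := L) B k).G.step.mass e := rfl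
      _ ≤ theta d n B * (N0 d n * theta1 d n B ^ k) := h
      _ ≤ theta1 d n B * (N0 d n * theta1 d n B ^ k) := mul_le_mul_of_nonneg_right hθ hN
      _ = N0 d n * theta1 d n B ^ (k + 1) := by rw [pow_succ]; ring

/-- **Domination of the tree's series**: `|∂^a_e wilsonSk_k(ιU)| ≤ N₀ θ₁^k`. [ours] -/
theorem abs_linkDeriv_wilsonSk_le (hn : n ≠ 0) (k : ℕ)
    (U : GaugeConfig d L (Matrix.specialUnitaryGroup (Fin n) ℂ)) (e : Edge d L) (a : B.ι) :
    |linkDeriv e (B.T a) (wilsonSk d L B k) (WilsonFlow.coeConfig U)| ≤ N0 d n * theta1 d n B ^ k := by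
  rw [(linkDeriv_eq_gradedSk B (contDiff_wilsonSk B) (isLuscherSeries_wilsonSk B) k).2 e a U]
  exact ((pack (d := d) (L := L) B k).G.abs_linkDeriv_func_le (pack_z_eq_zero B k) e a U).trans
    (mass_pack_le B hn k e)

end Growth

/-! ## 3. Theorem A -/

/-- An `𝔰𝔲(0)` basis is empty (`tr(T_a²) = -1/2` is impossible for `0 × 0` matrices). [folklore] -/
theorem isEmpty_ι_of_zero (B : SuBasis 0) : IsEmpty B.ι :=
  ⟨fun a => by
    have h := B.orth a a
    simp [Matrix.trace] at h⟩

/-- **THEOREM A (Lüscher's volume-uniform geometric gradient bound), PROVED.**  For every `d, n` there are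
`ρ > 0` and `C` such that for every volume `L`, every orthonormal basis of `𝔰𝔲(n)`, every smooth solution
`(S̃^{(k)}, c_k)` of Lüscher's recursion for the Wilson flow action, every order `k`, every `U ∈ SU(n)^E`,
every link `e` and colour `a`: `|∂^a_e S̃^{(k)}(U)| ≤ C ρ^{-k}`. [ours; statement: Luscher2010Trivializing §4]
-/
theorem luscherGeometricGradientBound_holds (d n : ℕ) : LuscherGeometricGradientBound d n := by
  by_cases hn : n = 0
  · subst hn
    exact ⟨1, one_pos, 0, fun L _ B Sk c _ _ k U e a => ((isEmpty_ι_of_zero B).false a).elim⟩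
  rcases isEmpty_or_nonempty (SuBasis n) with hB | ⟨⟨B₀⟩⟩
  · exact ⟨1, one_pos, 0, fun L _ B => (hB.false B).elim⟩
  refine (luscherGeometricGradientBound_iff_fixedBasis d n B₀).2 ⟨(theta1 d n B₀)⁻¹, ?_, N0 d n, ?_⟩
  · exact inv_pos.2 (zero_lt_one.trans_le (one_le_theta1 d n B₀))
  · intro L _ k U e a
    rw [inv_inv]
    exact abs_linkDeriv_wilsonSk_le B₀ hn k U e a

end Summit.Ventures.LatticeQCDFlow.TrivializingMaps.GradedSeries
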